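import Summits.BirchSwinnertonDyer.Rank1Residual.Additive.PadicBallLogSurj
import Summits.BirchSwinnertonDyer.Rank1Residual.O6.IntegralLogAdditiveHolds
import HarnessLib

/-!
# COROLLARY (a) of LEMMA A: at an ADDITIVE prime, `log_ω : E₁(K) ⥲ 𝔪_K` is an ISOMETRIC ISOMORPHISM for
# EVERY complete ultrametric field `K ⊇ ℚ_p` — `‖Λ(P)‖ = ‖z(P)‖` at every level, `Λ(P) = 0 ↔ P = O`,
# `Λ(E₁(K)) = {‖y‖ < 1}` (cell `b2b-bsdres`, team n1011, seat p05 GEN 13, ROW T-O6-LOGA F3, on top of the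
# x1b lane's local series `Additive/PadicBallLog*` and F1 `O6/IntegralLogAdditiveHolds`; theorems only)

HONEST FRAMING (cell `b2b-bsdres`, run/shared/lean/b2b/bsd-rank1-residual/, verbatim in every file): the
goal of the cell is to DELETE the COMBINATION-SHAPED residual classes of the Birch–Swinnerton-Dyer formula
for ALL analytic-rank `≤ 1` elliptic curves over `ℚ` — "full BSD formula for every rank `≤ 1` curve in
class `C`" assembled STRICTLY from published theorems — so that the rank-`≤ 1` remainder becomes exactly
the CONSTRUCTION-SHAPED classes, which are TYPED (missing-input `Prop`s), NOT attempted. This is not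
"finishing BSD". Lane CLASS-CLOSURE / teams o5–o6 (O6 OPEN) and team n1011 (N10/N11): research routes;
census output is EVIDENCE, never a Literature fact; nothing is booked; no mark of `RESIDUAL-MAP.md`
moves. This file: THEOREMS ONLY (no definition, no named fact, no `@[conjecture]` node, no `sorry`; net
named-fact debt `0`); nothing
about any particular curve is asserted.

## What is proved

Setting of the x1b local series (`Additive/PadicBallSeriesEval`, `FormalGroupBallPoints*`, `PadicBallLog`,
`PadicBallLogSurj`): `M/ℤ_p` with elliptic generic fibre, `K` a complete ultrametric normed field over
`ℚ_p`, `E = BallEval.curveK p K M = M ⊗ K`, `E₁(K) = FormalGroupChart.kernel`, `Λ = BallEval.ptLog =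
log_E ∘ z` (additive on `E₁(K)`: `BallEval.ptLog_add`). In general `Λ` is an isometry only below
`‖z‖ < 1/2` (`norm_ptLog_eq`), may kill `p`-power torsion (`exists_pow_smul_eq_zero_of_ptLog_eq_zero`) and
is onto a ball of radius `1/4` (`exists_ptLog_eq`). When the logarithm has INTEGRAL coefficients all three
defects disappear:

* §1 `BallEval.norm_qEval_sub_linear_le_sq` (`‖f(u) − f₁u‖ ≤ ‖u‖²` for `p`-integral `f`, `f₀ = 0`,
  `‖u‖ < 1`), `BallEval.qEval_X`.
* §2 under `hlog : ∀ n, ‖logₙ‖ ≤ 1`: **`BallEval.norm_bLog_eq_of_integral`** (`‖log t‖ = ‖t‖`, every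
  `‖t‖ < 1`), **`BallEval.norm_ptLog_eq_of_integral`** (`‖Λ(P)‖ = ‖z(P)‖` on all of `E₁(K)`),
  **`BallEval.ptLog_eq_zero_iff_of_integral`** (`Λ(P) = 0 ↔ P = O`), `BallEval.eq_of_ptLog_eq_of_integral`
  (`Λ` injective), and with `hexp : ∀ n, ‖expₙ‖ ≤ 1` as well **`BallEval.exists_ptLog_eq_of_integral`**
  (every `y` with `‖y‖ < 1` is `Λ(P)` with `‖z(P)‖ = ‖y‖`: `P = P(exp y)`, `log(exp y) = y` by
  `qEval_subst`).
* §3 **the minimal model of `W/ℚ` at an ADDITIVE prime** (`Addv W p`; `M = W_ℤ ⊗ ℤ_p`, generic fibre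
  `W ⊗ ℚ_p`; `log, exp ∈ ℤ_p⟦X⟧` by F1 `Additive.norm_coeff_formalLog_baseChange_le_one_of_addv` /
  `…formalExp…`): **`norm_ptLog_eq_of_addv`**, **`ptLog_eq_zero_iff_of_addv`**, **`exists_ptLog_eq_of_addv`**
  — for EVERY complete ultrametric normed `K ⊇ ℚ_p` (the layers `k_{n,𝔭}` of any `ℤ_p`-tower, `ℂ_p`, …),
  `log_ω : E₁(K) → 𝔪_K = {‖y‖ < 1}` is an isometric group isomorphism. This is o6-r1's COROLLARY (a) of
  LEMMA A (GEN 16 memo §1; `cells/o5o6/TARGETS.md` (G16-1): "`log_ω : W₁^ℚ(K) ≅ 𝔪_K` for every finite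
  `K/ℚ_p`, wild included") in the kernel; corollary (b) (torsion-freeness, completeness-free) is F2b
  `Additive/AdditiveKernelMultiplicationByP.lean`; (c)'s containment `𝔪_K ⊆ 𝓜_K := Λ(W(K))` is immediate
  from §3; (d) (`exp* H¹_{/f} = 𝓜_K^⊥`) needs Bloch–Kato's `exp*` (no tree vocabulary) and is NOT claimed.

References: J. H. Silverman, *The Arithmetic of Elliptic Curves*, GTM 106 (2009), IV.5–IV.6 (Prop. IV.6.4),
Prop. VII.2.2 [SilvermanAEC2009]; S. Kobayashi, Invent. Math. 152 (2003) §8.4 (the logarithm on `E₁(k_n)`)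
[Kobayashi2003]; T. Honda, J. Math. Soc. Japan 22 (1970) Thm. 2 [Honda1970]; M. Kosters, R. Pannekoek,
arXiv:1703.07888 (structure of `E₁(K)`; ramified case open, p. 8) — prose; o6-r1 GEN 16 memo
`HOME/b2b-bsdres-o6-r1/gen16/O6-GEN16.md` §1.
-/

noncomputable section

open scoped Classical Topology NNReal
open Filter PowerSeries

namespace Summit.BirchSwinnertonDyer.Rank1Residual.Additive

namespace BallEval

open Literature.NumberTheory.GaloisRepresentations.LubinTate (unitBall mem_unitBall_iff)
open Literature.NumberTheory.EllipticCurves Literature.NumberTheory.EllipticCurves.FormalGroupChart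
open WeierstrassCurve

variable (p : ℕ) [hp : Fact p.Prime] (K : Type*) [NontriviallyNormedField K] [NormedAlgebra ℚ_[p] K]
  [IsUltrametricDist K] [CompleteSpace K] (M : WeierstrassCurve ℤ_[p])

/-! ## §1 Series with INTEGRAL coefficients: `‖f(u) − f₁u‖ ≤ ‖u‖²` -/

variable {p K M}

/-- **`‖qEval f u − f₁·u‖ ≤ ‖u‖²`** for a `ℚ_p`-series with `p`-INTEGRAL coefficients and `f₀ = 0`, at
`‖u‖ < 1` (every tail term `fₙuⁿ`, `n ≥ 2`, has norm `≤ ‖u‖²`). [cite: SilvermanAEC2009, IV.6.3] -/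
theorem norm_qEval_sub_linear_le_sq {f : ℚ_[p]⟦X⟧} (hf : ∀ n, ‖coeff n f‖ ≤ n) (hf1 : ∀ n, ‖coeff n f‖ ≤ 1)
    {u : K} (hu : ‖u‖ < 1) : ‖qEval p K f u - algebraMap ℚ_[p] K (coeff 1 f) * u‖ ≤ ‖u‖ ^ 2 := by
  have hs := summable_qEval (K := K) hf hu
  have h2 : qEval p K f u - algebraMap ℚ_[p] K (coeff 1 f) * u =
      ∑' n : ℕ, algebraMap ℚ_[p] K (coeff (n + 2) f) * u ^ (n + 2) := by
    rw [qEval, ← hs.sum_add_tsum_nat_add 2, Finset.sum_range_succ, Finset.sum_range_succ,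
      Finset.sum_range_zero, coeff_zero_eq_zero hf, map_zero, zero_mul, zero_add, zero_add, pow_one,
      add_sub_cancel_left]
  rw [h2]
  refine IsUltrametricDist.norm_tsum_le_of_forall_le_of_nonneg (sq_nonneg _) fun n => ?_
  rw [norm_mul, norm_pow, norm_algebraMap_padic, pow_add, mul_comm (‖u‖ ^ n), ← mul_assoc]
  calc ‖coeff (n + 2) f‖ * ‖u‖ ^ 2 * ‖u‖ ^ n ≤ 1 * ‖u‖ ^ 2 * 1 := by
        refine mul_le_mul (mul_le_mul_of_nonneg_right (hf1 _) (sq_nonneg _))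
          (pow_le_one₀ (norm_nonneg _) hu.le) (pow_nonneg (norm_nonneg _) _) ?_
        exact mul_nonneg zero_le_one (sq_nonneg _)
    _ = ‖u‖ ^ 2 := by rw [one_mul, mul_one]

omit [IsUltrametricDist K] [CompleteSpace K] in
/-- `qEval X u = u`. [folklore] -/
theorem qEval_X (u : K) : qEval p K (X : ℚ_[p]⟦X⟧) u = u := by
  rw [qEval, tsum_eq_single 1]
  · rw [coeff_one_X, map_one, one_mul, pow_one]
  · intro n hn
    rw [coeff_X, if_neg hn, map_zero, zero_mul]

/-! ## §2 The logarithm with integral coefficients is an ISOMETRY of `E₁(K)` onto the open unit ball -/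

section IntegralLog

variable (hlog : ∀ n, ‖coeff n (logQ p M)‖ ≤ 1)
include hlog

/-- **`‖log(t)‖ = ‖t‖` at EVERY level `‖t‖ < 1`** when `log ∈ ℤ_p⟦X⟧` (`‖log t − t‖ ≤ ‖t‖² < ‖t‖`).
[cite: SilvermanAEC2009, IV.6.4] -/
theorem norm_bLog_eq_of_integral {t : K} (ht : ‖t‖ < 1) : ‖bLog p K M t‖ = ‖t‖ := by
  by_cases h0 : t = 0
  · rw [h0, bLog, qEval_zero (norm_coeff_logQ_le (p := p) (M := M)), norm_zero]
  have hpos : 0 < ‖t‖ := norm_pos_iff.mpr h0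
  have hb : ‖bLog p K M t - t‖ ≤ ‖t‖ ^ 2 := by
    have h := norm_qEval_sub_linear_le_sq (K := K) (norm_coeff_logQ_le (p := p) (M := M)) hlog ht
    rwa [coeff_one_logQ, map_one, one_mul] at h
  have hlt' : ‖bLog p K M t - t‖ < ‖t‖ := by
    refine hb.trans_lt ?_
    calc ‖t‖ ^ 2 = ‖t‖ * ‖t‖ := sq _
      _ < ‖t‖ * 1 := mul_lt_mul_of_pos_left ht hpos
      _ = ‖t‖ := mul_one _
  have e : bLog p K M t = (bLog p K M t - t) + t := by ring
  rw [e, IsUltrametricDist.norm_add_eq_max_of_norm_ne_norm (ne_of_lt hlt'), max_eq_right hlt'.le]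

variable [hE : (M.map PadicInt.Coe.ringHom).IsElliptic]
  [hint : (curveK p K M).IsIntegral (NormedField.valuation (K := K)).integer]

omit hE in
/-- **`‖Λ(P)‖ = ‖z(P)‖` on ALL of `E₁(K)`** when `log ∈ ℤ_p⟦X⟧` — the logarithm is an isometry at every
level, not only below `‖z‖ < 1/2` (the general `norm_ptLog_eq`). [cite: SilvermanAEC2009, IV.6.4] -/
theorem norm_ptLog_eq_of_integral {P : (curveK p K M).toAffine.Point}
    (hP : P ∈ kernel (NormedField.valuation (K := K)) (curveK p K M)) :
    ‖ptLog p K M P‖ = ‖P.zCoord‖ := by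
  rw [ptLog]
  exact norm_bLog_eq_of_integral hlog (norm_zCoord_lt_one hP)

omit hE in
/-- **`Λ` is INJECTIVE on `E₁(K)`** when `log ∈ ℤ_p⟦X⟧`: `Λ(P) = 0 ↔ P = O` — no `p`-power torsion is
lost (compare the general `exists_pow_smul_eq_zero_of_ptLog_eq_zero`). [cite: SilvermanAEC2009, IV.6.4] -/
theorem ptLog_eq_zero_iff_of_integral {P : (curveK p K M).toAffine.Point}
    (hP : P ∈ kernel (NormedField.valuation (K := K)) (curveK p K M)) :
    ptLog p K M P = 0 ↔ P = 0 := by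
  refine ⟨fun h0 ↦ ?_, fun h0 ↦ by rw [h0, ptLog_zero]⟩
  have hz : ‖P.zCoord‖ = 0 := by rw [← norm_ptLog_eq_of_integral hlog hP, h0, norm_zero]
  exact (zCoord_eq_zero_iff hP).mp (norm_eq_zero.mp hz)

/-- Injectivity of `Λ` on `E₁(K)` as a statement about pairs (with additivity `ptLog_add` this is
`Λ(P) = Λ(Q) ↔ P = Q`; here the torsion-free form). [folklore] -/
theorem eq_of_ptLog_eq_of_integral {P Q : (curveK p K M).toAffine.Point}
    (hP : P ∈ kernel (NormedField.valuation (K := K)) (curveK p K M))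
    (hQ : Q ∈ kernel (NormedField.valuation (K := K)) (curveK p K M))
    (h : ptLog p K M P = ptLog p K M Q) : P = Q := by
  have hPQ : P - Q ∈ kernel (NormedField.valuation (K := K)) (curveK p K M) :=
    (kernel (NormedField.valuation (K := K)) (curveK p K M)).sub_mem hP hQ
  have hsub : ptLog p K M (P - Q) = 0 := by
    have hadd := ptLog_add hPQ hQ
    rw [sub_add_cancel] at hadd
    rw [hadd] at h
    linear_combination h
  exact sub_eq_zero.mp ((ptLog_eq_zero_iff_of_integral hlog hPQ).mp hsub)

/-- **`Λ` maps `E₁(K)` ONTO the open unit ball `𝔪_K = {‖y‖ < 1}`, isometrically**, when BOTH `log` and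
`exp = log⁻¹` lie in `ℤ_p⟦X⟧`: for `‖y‖ < 1` the point `P = P(exp(y))` has `Λ(P) = y` and `‖z(P)‖ = ‖y‖`
(compare the general `exists_ptLog_eq`, which reaches `‖y‖ ≤ 1/4` only). [cite: SilvermanAEC2009, IV.6.4] -/
theorem exists_ptLog_eq_of_integral (hexp : ∀ n, ‖coeff n (M.map (PadicInt.Coe.ringHom (p := p))).formalExp‖ ≤ 1)
    {y : K} (hy : ‖y‖ < 1) :
    ∃ P ∈ kernel (NormedField.valuation (K := K)) (curveK p K M), ptLog p K M P = y ∧ ‖P.zCoord‖ = ‖y‖ := by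
  set W₁ := M.map (PadicInt.Coe.ringHom (p := p)) with hW₁
  -- the integral exponential
  obtain ⟨G, hG⟩ := isPadicInt_iff_exists_powerSeries_map.mp (isPadicInt_iff_coeff.mpr hexp)
  have hG0 : constantCoeff G = 0 := by
    have h := congrArg constantCoeff hG
    rw [W₁.constantCoeff_formalExp, ← coeff_zero_eq_constantCoeff, coeff_map,
      coeff_zero_eq_constantCoeff] at h
    have h' : ((constantCoeff G : ℤ_[p]) : ℚ_[p]) = 0 := h
    exact PadicInt.coe_eq_zero.mp h'
  set yb : unitBall K := ⟨y, (mem_unitBall_iff K).mpr hy.le⟩ with hyb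
  have hyb1 : ‖(yb : K)‖ < 1 := hy
  set t : K := ((ev₁ p K yb (hasEval_of_norm_lt_one hyb1) G : unitBall K) : K) with htdef
  have hty : ‖t‖ ≤ ‖y‖ := norm_ev₁_le _ hy.le hG0
  have ht1 : ‖t‖ < 1 := hty.trans_lt hy
  -- `log(exp(y)) = y`
  have hlogt : bLog p K M t = y := by
    have h := qEval_subst (K := K) (norm_coeff_logQ_le (p := p) (M := M)) hG0 hyb1
    rw [hG, logQ, W₁.formalLog_subst_formalExp, qEval_X] at h
    rw [bLog, logQ, ← h]
  refine ⟨pt p K M t, pt_mem_kernel t, ?_, ?_⟩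
  · rw [ptLog_pt ht1, hlogt]
  · rw [zCoord_pt ht1, ← norm_bLog_eq_of_integral hlog ht1, hlogt]

end IntegralLog

end BallEval

/-! ## §3 The minimal model of `W/ℚ` at an ADDITIVE prime: `log_ω : E₁(K) ⥲ 𝔪_K` for every complete `K` -/

section Additive

open BallEval
open Literature.NumberTheory.GaloisRepresentations.LubinTate (unitBall mem_unitBall_iff)
open Literature.NumberTheory.EllipticCurves Literature.NumberTheory.EllipticCurves.FormalGroupChart
  Literature.NumberTheory.EllipticCurves.Rank1Residual WeierstrassCurve

variable (W : WeierstrassCurve ℚ) [W.IsElliptic] [W.IsGloballyMinimal] (p : ℕ) [hp : Fact p.Prime]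
  (K : Type*) [NontriviallyNormedField K] [NormedAlgebra ℚ_[p] K] [IsUltrametricDist K] [CompleteSpace K]

omit [W.IsGloballyMinimal] in
/-- `W_ℤ ⊗ ℤ_p ⊗ ℚ_p = W ⊗ ℚ_p` is elliptic (the x1b local series' hypothesis `hE`, as a THEOREM to be
introduced with `haveI`; the equation is the tree's `map_coe_integralModelInt`). [folklore] -/
theorem isElliptic_map_coe_integralModelInt [W.IsGloballyMinimal] :
    (((integralModelInt W).map (Int.castRingHom ℤ_[p])).map PadicInt.Coe.ringHom).IsElliptic := by
  rw [map_coe_integralModelInt]; infer_instance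

/-- At an additive prime the x1b series' `logQ` of `W_ℤ ⊗ ℤ_p` has integral coefficients (F1
`Additive.norm_coeff_formalLog_baseChange_le_one_of_addv`). [cite: Honda1970, Thm. 2 (p. 223)] -/
theorem norm_coeff_logQ_le_one_of_addv (hadd : Addv W p) (n : ℕ) :
    ‖coeff n (logQ p ((integralModelInt W).map (Int.castRingHom ℤ_[p])))‖ ≤ 1 := by
  rw [logQ, map_coe_integralModelInt]
  exact norm_coeff_formalLog_baseChange_le_one_of_addv W p hadd n

/-- **COROLLARY (a) of LEMMA A — `log_ω` is an ISOMETRY of `E₁(K)` at an additive prime, every complete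
`K`**: for `W/ℚ` globally minimal with `Addv W p`, `K` ANY complete ultrametric normed field over `ℚ_p`
(e.g. the layers `k_{n,𝔭}` of a `ℤ_p`-tower, however ramified) and `P ∈ E₁(K)` of `W_ℤ ⊗ K`
(`= BallEval.curveK p K (W_ℤ ⊗ ℤ_p)`): `‖Λ(P)‖ = ‖z(P)‖`, `Λ = log_ω ∘ z` the x1b local series' `ptLog`.
[cite: SilvermanAEC2009, IV.6.4 and VII.2.2] -/
theorem norm_ptLog_eq_of_addv (hadd : Addv W p)
    [hint : (curveK p K ((integralModelInt W).map (Int.castRingHom ℤ_[p]))).IsIntegral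
      (NormedField.valuation (K := K)).integer]
    {P : (curveK p K ((integralModelInt W).map (Int.castRingHom ℤ_[p]))).toAffine.Point}
    (hP : P ∈ kernel (NormedField.valuation (K := K)) (curveK p K ((integralModelInt W).map (Int.castRingHom ℤ_[p])))) :
    ‖ptLog p K ((integralModelInt W).map (Int.castRingHom ℤ_[p])) P‖ = ‖P.zCoord‖ :=
  haveI := isElliptic_map_coe_integralModelInt W p
  norm_ptLog_eq_of_integral (norm_coeff_logQ_le_one_of_addv W p hadd) hP

/-- **COROLLARY (a), injectivity: `Λ(P) = 0 ↔ P = O` on `E₁(K)` at an additive prime** (so `E₁(K)` has no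
`p`-power torsion — cf. the completeness-free `Additive.zsmul_ne_zero_of_addv_of_one_lt_val`).
[cite: SilvermanAEC2009, IV.6.4 and VII.2.2] -/
theorem ptLog_eq_zero_iff_of_addv (hadd : Addv W p)
    [hint : (curveK p K ((integralModelInt W).map (Int.castRingHom ℤ_[p]))).IsIntegral
      (NormedField.valuation (K := K)).integer]
    {P : (curveK p K ((integralModelInt W).map (Int.castRingHom ℤ_[p]))).toAffine.Point}
    (hP : P ∈ kernel (NormedField.valuation (K := K)) (curveK p K ((integralModelInt W).map (Int.castRingHom ℤ_[p])))) :
    ptLog p K ((integralModelInt W).map (Int.castRingHom ℤ_[p])) P = 0 ↔ P = 0 :=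
  haveI := isElliptic_map_coe_integralModelInt W p
  ptLog_eq_zero_iff_of_integral (norm_coeff_logQ_le_one_of_addv W p hadd) hP

/-- **COROLLARY (a), surjectivity: at an additive prime `Λ(E₁(K)) = 𝔪_K`** — every `y ∈ K` with `‖y‖ < 1`
is `Λ(P)` for a point `P ∈ E₁(K)` with `‖z(P)‖ = ‖y‖` (`exp_W ∈ ℤ_p⟦X⟧` as well, F1
`Additive.norm_coeff_formalExp_baseChange_le_one_of_addv`). With x1b's `ptLog_add`, **`log_ω : E₁(K) ⥲ 𝔪_K`
is an isometric isomorphism of groups** — o6-r1's corollary (a) of LEMMA A for EVERY complete `K ⊇ ℚ_p`.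
[cite: SilvermanAEC2009, IV.6.4 and VII.2.2] -/
theorem exists_ptLog_eq_of_addv (hadd : Addv W p)
    [hint : (curveK p K ((integralModelInt W).map (Int.castRingHom ℤ_[p]))).IsIntegral
      (NormedField.valuation (K := K)).integer]
    {y : K} (hy : ‖y‖ < 1) :
    ∃ P ∈ kernel (NormedField.valuation (K := K)) (curveK p K ((integralModelInt W).map (Int.castRingHom ℤ_[p]))),
      ptLog p K ((integralModelInt W).map (Int.castRingHom ℤ_[p])) P = y ∧ ‖P.zCoord‖ = ‖y‖ := by
  haveI := isElliptic_map_coe_integralModelInt W p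
  refine exists_ptLog_eq_of_integral (norm_coeff_logQ_le_one_of_addv W p hadd) (fun n ↦ ?_) hy
  rw [map_coe_integralModelInt]
  exact norm_coeff_formalExp_baseChange_le_one_of_addv W p hadd n

end Additive

end Summit.BirchSwinnertonDyer.Rank1Residual.Additive
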